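import Mathlib
import HarnessLib
import Summits.AtomisticToContinuum.FouriersLaw.Theses.JunctionLocality
import Summits.AtomisticToContinuum.FouriersLaw.Theses.LocalOhmBV
import Summits.AtomisticToContinuum.FouriersLaw.Theses.TransferKernelPositivity

/-!
# Strategy census s2 / instance LOBV — typed companion for crux `ConductanceLowerBound`
(stmt-AtomisticToContinuum-11749), crux-strategist seat `cstrat-stmt-AtomisticToContinuum-11749-s2`,
instance launched with bet route `route-AtomisticToContinuum-LocalOhmBV`, 2026-08-17.

Companion of `STRATEGY-CENSUS-s2-LOBV.md` (same crux directory).  It TYPES the one strengthening of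
the crux that is native to the LocalOhmBV / TransferKernelPositivity vocabulary (kinetic-temperature
RESPONSE PROFILES `θ_N`) and PROVES that it implies the crux by name, using only CLOSED items of those
routes as side hypotheses.  Nothing here is a line: no `stub_*`, no registered composition; the live
skeleton `Lines/ForecastSensitivitySketch.lean` and the sibling instances' files
(`StrategyCensusS2.lean`, `StrategyCensusS2LCR.lean`) are untouched and not imported.

* §1 `ReverseLocalOhm` — "NO KINETIC-TEMPERATURE DROP WITHOUT CURRENT", the mirror image of the
  routes' crux `LocalOhm` (stmt-12009, "no current without a drop"): along the crux data, at EVERY bond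
  `|θ_N(i+1) − θ_N(i)| ≤ C · |D_N| / (N − 1)` with `C` independent of `N`.
* §2 `telescope_bound` — the finite-sum lemma: a per-bond bound `B` on `|θ(i+1) − θ(i)|` gives
  `θ(0) − θ(N−1) ≤ (N−1) B`.
* §3 `conductanceLowerBound_of_reverseLocalOhm :
     ReverseLocalOhm → TransferKernelPositivity.ContactIdentity → LocalOhmBV.FiniteResponseProfile →
     JunctionLocality.PositiveConductance → JunctionLocality.ConductanceLowerBound` — PROVED.
  The three side hypotheses are CLOSED ledger items (stmt-12015 `transferKernelPositivity_contactIdentity_proof`,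
  stmt-12011 `finiteResponseProfile_proof`, stmt-11750 `positiveConductance_holds`), so `ReverseLocalOhm`
  ALONE implies the crux given the tree: it is a genuine strengthening `S⁺`, with the explicit constant
  `c = 1 / (max C 0 + 2/γ)` and `N₁ = 2`.
  Arithmetic: ContactIdentity gives `θ_N(0) − θ_N(N−1) = 1 − 2 D_N /(γ (N−1))`; telescoping and
  `ReverseLocalOhm` give `θ_N(0) − θ_N(N−1) ≤ C |D_N|`; with `D_N > 0` (PositiveConductance) this is
  `γ ≤ γ C D_N + 2 D_N/(N−1) ≤ (γ C + 2) D_N`.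

Why this buys nothing for THIS step (census §Strengthen S8): `ReverseLocalOhm` is the crux localised to
one bond — strictly stronger, and by `BathFreeKineticStep` (s1, `StrategyCensus.lean` §3) plus the
`L²`/KAM-island remark of the census it admits no LOCAL certificate from bulk stationarity; any proof
must propagate the contact Fisher information hypoelliptically to distance `≍ N/2` (barrier
`SpectralGapClosing`).  It is recorded because it is the EXACT lower-half twin of `LocalOhm` in the bet
route's own language (LocalOhm is false at the harmonic corner, ReverseLocalOhm is true there), i.e. the
statement a LocalOhmBV tenure planner would file if the route wanted its own supplier of the child
`ConductanceLowerBound` — and because its glue is now kernel-checked rather than asserted.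
-/

noncomputable section

open MeasureTheory Filter Topology
open Literature.MathematicalPhysics.KineticTheory.HeatConduction

namespace Summit.AtomisticToContinuum.FouriersLaw.Cruxes.ConductanceLowerBound.StrategyCensusS2LOBV

open Summit.AtomisticToContinuum.FouriersLaw.Theses

/-! ## §1 The strengthening `ReverseLocalOhm` -/

/-- **S8 — REVERSE LOCAL OHM INEQUALITY ("no kinetic-temperature drop without current").**
In the crux frame (parameters `> 0`, weak-NESS uniqueness, a steady-state family `μ`, `T > 0`): there is
`C` (depending on the parameters and `T`, NOT on `N`) such that for every `N`, every response coefficient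
`d` of the total current and every kinetic-temperature response profile `θ` (all difference quotients
converging, as in `LocalOhm` / `BVProfile` / `ContactIdentity`), at EVERY bond `(i, i+1)`:
`|θ (i+1) − θ i| ≤ C · |d| / (N − 1)` (`d/(N−1)` = per-bond current response).  Mirror image of
`TransferKernelPositivity.LocalOhm` / `LocalOhmBV.LocalOhm` (which bound the current by the windowed
drop); true at the harmonic corner (flat bulk profile, `d/(N−1) → c_∞ > 0`), false for an insulating
profile (a drop with `d/(N−1) = o(1/N)`).  Strictly STRONGER than `ConductanceLowerBound` (§3). -/
def ReverseLocalOhm : Prop :=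
  ∀ ω₂ lam β γ : ℝ, 0 < ω₂ → 0 < lam → 0 < β → 0 < γ →
    (∀ (N : ℕ) (T_L T_R : ℝ), 0 < T_L → 0 < T_R → ∀ μ ν : Measure (PhaseSpace N),
      (pinnedChain ω₂ lam β γ).IsSteadyState N T_L T_R μ →
      (pinnedChain ω₂ lam β γ).IsSteadyState N T_L T_R ν → μ = ν) →
    ∀ μ : (N : ℕ) → ℝ → ℝ → Measure (PhaseSpace N),
      (∀ (N : ℕ) (T_L T_R : ℝ), 0 < T_L → 0 < T_R →
        (pinnedChain ω₂ lam β γ).IsSteadyState N T_L T_R (μ N T_L T_R)) →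
      ∀ T : ℝ, 0 < T → ∃ C : ℝ, ∀ (N : ℕ) (d : ℝ) (θ : Fin N → ℝ),
        Tendsto (fun δ : ℝ =>
          (pinnedChain ω₂ lam β γ).totalCurrent (μ N (T + δ / 2) (T - δ / 2)) / δ)
          (nhdsWithin 0 {(0 : ℝ)}ᶜ) (nhds d) →
        (∀ i : Fin N, Tendsto (fun δ : ℝ =>
          ((∫ x, (x.2 i) ^ 2 ∂(μ N (T + δ / 2) (T - δ / 2))) - ∫ x, (x.2 i) ^ 2 ∂(μ N T T)) / δ)
          (nhdsWithin 0 {(0 : ℝ)}ᶜ) (nhds (θ i))) →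
        ∀ i j : Fin N, j.val = i.val + 1 → |θ j - θ i| ≤ C * |d| / ((N : ℝ) - 1)

/-! ## §2 Telescoping -/

/-- A per-bond bound `B` on the profile increments bounds the end-to-end drop by `(N−1) B`. -/
theorem telescope_bound {N : ℕ} (hN : 2 ≤ N) (θ : Fin N → ℝ) (B : ℝ)
    (hb : ∀ i j : Fin N, j.val = i.val + 1 → |θ j - θ i| ≤ B) :
    θ ⟨0, by omega⟩ - θ ⟨N - 1, by omega⟩ ≤ ((N : ℝ) - 1) * B := by
  set f : ℕ → ℝ := fun k => if h : k < N then θ ⟨k, h⟩ else 0 with hf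
  have hf0 : f 0 = θ ⟨0, by omega⟩ := by
    simp only [hf, dif_pos (show (0 : ℕ) < N by omega)]
  have hfN : f (N - 1) = θ ⟨N - 1, by omega⟩ := by
    simp only [hf, dif_pos (show N - 1 < N by omega)]
  have hstep : ∀ k, k + 1 < N → f k - f (k + 1) ≤ B := by
    intro k hk
    have hk' : k < N := by omega
    have e1 : f k = θ ⟨k, hk'⟩ := by simp only [hf, dif_pos hk']
    have e2 : f (k + 1) = θ ⟨k + 1, hk⟩ := by simp only [hf, dif_pos hk]
    rw [e1, e2]
    have h1 := hb ⟨k, hk'⟩ ⟨k + 1, hk⟩ rfl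
    have h2 : θ ⟨k, hk'⟩ - θ ⟨k + 1, hk⟩ ≤ |θ ⟨k + 1, hk⟩ - θ ⟨k, hk'⟩| := by
      rw [abs_sub_comm]
      exact le_abs_self _
    exact h2.trans h1
  have hsum : ∑ k ∈ Finset.range (N - 1), (f k - f (k + 1)) = f 0 - f (N - 1) :=
    Finset.sum_range_sub' f (N - 1)
  have hle : ∑ k ∈ Finset.range (N - 1), (f k - f (k + 1)) ≤ ∑ _k ∈ Finset.range (N - 1), B :=
    Finset.sum_le_sum fun k hk => hstep k (by have := Finset.mem_range.mp hk; omega)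
  rw [Finset.sum_const, Finset.card_range, nsmul_eq_mul, hsum, hf0, hfN] at hle
  have hcast : ((N - 1 : ℕ) : ℝ) = (N : ℝ) - 1 := by
    rw [Nat.cast_sub (by omega)]
    simp
  rw [hcast] at hle
  exact hle

/-! ## §3 The strengthening implies the crux (side hypotheses = CLOSED items) -/

/-- **`ReverseLocalOhm` ⟹ `ConductanceLowerBound`** given the CLOSED items `ContactIdentity`
(stmt-12015), `FiniteResponseProfile` (stmt-12011) and `PositiveConductance` (stmt-11750); explicit
constant `c = 1/(max C 0 + 2/γ)`, threshold `N₁ = 2`. -/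
theorem conductanceLowerBound_of_reverseLocalOhm
    (hR : ReverseLocalOhm) (hCI : TransferKernelPositivity.ContactIdentity)
    (hFP : LocalOhmBV.FiniteResponseProfile) (hP : JunctionLocality.PositiveConductance) :
    JunctionLocality.ConductanceLowerBound := by
  intro ω₂ lam β γ hω hl hβ hγ huniq μ hμ T hT D hD
  obtain ⟨C, hC⟩ := hR ω₂ lam β γ hω hl hβ hγ huniq μ hμ T hT
  have hpos : ∀ N : ℕ, 2 ≤ N → 0 < D N := hP ω₂ lam β γ hω hl hβ hγ huniq μ hμ T hT D hD
  set C' : ℝ := max C 0 with hC'def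
  have hC'0 : 0 ≤ C' := le_max_right _ _
  have hden : 0 < C' + 2 / γ := by positivity
  refine ⟨1 / (C' + 2 / γ), by positivity, 2, fun N hN => ?_⟩
  -- the response profile of the `N`-chain (closed item FiniteResponseProfile)
  have hθex := hFP ω₂ lam β γ hω hl hβ hγ huniq μ hμ T hT N
  choose θ hθ using hθex
  -- contact identities (closed item ContactIdentity)
  obtain ⟨h0, h1⟩ := hCI ω₂ lam β γ hω hl hβ hγ huniq μ hμ T hT N hN (θ ⟨0, by omega⟩)
    (θ ⟨N - 1, by omega⟩) (D N) (hθ _) (hθ _) (hD N)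
  -- per-bond bound with the non-negative constant C'
  have hN1 : (0 : ℝ) < (N : ℝ) - 1 := by
    have : (2 : ℝ) ≤ N := by exact_mod_cast hN
    linarith
  have hb : ∀ i j : Fin N, j.val = i.val + 1 → |θ j - θ i| ≤ C' * |D N| / ((N : ℝ) - 1) := by
    intro i j hij
    refine (hC N (D N) θ (hD N) hθ i j hij).trans ?_
    apply div_le_div_of_nonneg_right _ hN1.le
    exact mul_le_mul_of_nonneg_right (le_max_left _ _) (abs_nonneg _)
  -- telescoping: θ(0) − θ(N−1) ≤ (N−1) · C' |D N| /(N−1) = C' |D N|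
  have htel := telescope_bound hN θ _ hb
  have hDpos : 0 < D N := hpos N hN
  have habs : |D N| = D N := abs_of_pos hDpos
  rw [habs] at htel
  have htel' : θ ⟨0, by omega⟩ - θ ⟨N - 1, by omega⟩ ≤ C' * D N := by
    have e : ((N : ℝ) - 1) * (C' * D N / ((N : ℝ) - 1)) = C' * D N := by
      field_simp
    linarith [htel, e.le, e.ge]
  -- contact identities: θ(0) − θ(N−1) = 1 − 2 D N /(γ (N−1)), in product form
  set M : ℝ := (N : ℝ) - 1 with hMdef
  have hMpos : 0 < M := hN1
  have hM1 : 1 ≤ M := by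
    have : (2 : ℝ) ≤ N := by exact_mod_cast hN
    simp only [hMdef]; linarith
  -- h0 : D N = γ * M * (1/2 - θ0), h1 : D N = γ * M * (θ1 + 1/2)
  have key : γ * M - 2 * D N ≤ γ * M * (C' * D N) := by
    have e1 : γ * M * (θ ⟨0, by omega⟩ - θ ⟨N - 1, by omega⟩) = γ * M - 2 * D N := by
      linear_combination h0 + h1
    have hγM : 0 ≤ γ * M := by positivity
    calc γ * M - 2 * D N = γ * M * (θ ⟨0, by omega⟩ - θ ⟨N - 1, by omega⟩) := e1.symm
      _ ≤ γ * M * (C' * D N) := mul_le_mul_of_nonneg_left htel' hγM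
  -- divide by M ≥ 1: γ ≤ γ C' D + 2 D
  have h5 : γ * M ≤ (γ * C' * D N + 2 * D N) * M := by
    nlinarith [mul_nonneg hDpos.le (sub_nonneg.mpr hM1)]
  have h6 : γ ≤ γ * C' * D N + 2 * D N := le_of_mul_le_mul_right h5 hMpos
  -- conclude 1/(C' + 2/γ) ≤ D N
  rw [div_le_iff₀ hden]
  have e3 : D N * (C' + 2 / γ) = (γ * C' * D N + 2 * D N) / γ := by
    field_simp
  rw [e3, le_div_iff₀ hγ]
  linarith

/-! ## §4 Sanity: the crux does NOT give `ReverseLocalOhm` back for free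

(`ReverseLocalOhm` is strictly stronger: it quantifies a bound at EVERY bond, the crux only the corner
value.)  No Lean statement is made here; the census records the insulating-bond-in-a-conductor
caricature (a conductor with `D_N ≥ c` may still have one `O(1)` drop) as the separating example. -/

end Summit.AtomisticToContinuum.FouriersLaw.Cruxes.ConductanceLowerBound.StrategyCensusS2LOBV

end
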